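import Summits.CriticalPhenomena.PercolationContinuityZ3.Theorems.PercNearOneGluingNoHeavyLowerTailSahiCoordinateTwoThirds
import Mathlib.Tactic.Linarith
import Mathlib.Tactic.Ring
import HarnessLib

/-!
# `NoHeavyLowerTail` (crux stmt-CriticalPhenomena-4575), master-family line P2: the ANTITONE FORM of the two-thirds conjecture —
# `E_k(μ_p; U) / μ_p(⊤)` is order-reversing in `p` — typed for every order `k`, with its one-line reduction to Sahi's `C_k` on cubes,
# and PROVED equivalent (forward direction) to (T3∀) at `k = 3`

Support file (seat `prim-masterthm-p2`, gen 12; `--supports stmt-CriticalPhenomena-4575`); ONE `@[conjecture]` definition (`MasterAntitone`, an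
obligation of THIS programme — census-backed, NOT a published fact), no sorry.  Memo SAHI-ROUTE.md §4.35.

THE OBSERVATION (gen 12).  For an increasing triple `U` on a finite cube and a coordinate `e`, the fibre cubic `s ↦ E(s) := E_3(μ_{p[e↦s]}; 1_U)`
satisfies `E(1) − E'(1) = 3B₂(e) − 2B₃(e) = coordPiece₂(e) + E_3(U^{e←0})` (Bernstein coefficients `B_j`).  Hence gen 11's conjecture (T3∀)
(`SahiCoordinateTwoThirds.TwoThirds`: `coordPiece₂(e) + E_3(U^{e←0}) ≥ 0` at EVERY coordinate) says exactly that `s ↦ E(s)/s` is non-increasing on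
`(0,1]`, i.e. that **`p ↦ E_3(μ_p; 1_U) / ∏_e p_e = E_3(μ_p; 1_U)/μ_p({⊤})` is ANTITONE on the cube of parameters**; since its value at `p ≡ 1` is
`E_3(δ_⊤; 1,1,1) = 0`, (T3∀) gives Kahn's `C_3` in one line.  The same statement makes sense for every order:
**CONJECTURE (MT-k)** (`MasterAntitone k`): for increasing `U_0,…,U_{k−1}` and parameters `p ≤ p'` (coordinatewise),
`E_k(μ_{p'}; 1_U)·∏ p_e ≤ E_k(μ_p; 1_U)·∏ p'_e`.  It is a THEOREM for `k ≤ 2` (`k = 2`: `Cov(s)·s' − Cov(s')·s = (s'−s)[Cov(U^{e←0}) + ss'ν_Aν_B] ≥ 0`,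
Harris on the sections; paper), it is EQUIVALENT to (T3∀) for `k = 3` (forward direction proved here, `masterAntitone_three_of_twoThirds`; the converse is the
limit `s → 1` in `E(s) ≥ sE(1)`, paper), and it implies `MasterFamilyNonneg k` for every `k ≥ 2` (`masterFamilyNonneg_of_masterAntitone`: take `p' ≡ 1`,
where the product weight is `δ_⊤`, expectation is multiplicative and every `E_k`, `k ≥ 2`, vanishes — `sahiE_eq_zero_of_ex_mul`).
EQUIVALENT FORMS of (T3∀) recorded in the memo (paper): (a) `E_3(μ_p)/μ_p(⊤)` antitone; (b) for product measures `μ_q ≤ μ_p` the LINEARISATION of the cubic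
functional `E_3` at `μ_p` towards `μ_q` is `≥ 0`: `2δ_{ABC} ≤ E_3(μ_p) + Σ_cyc δ_A·Cov_p(B,C) + Σ_cyc μ_p(A)·δ_{BC}`, `δ = μ_p − μ_q` (`q = p` is `C_3`);
(c) Sahi's generating function `G = exp E log(1 − Σ t_i f_i)` interpolates GEOMETRICALLY along a coordinate, `G(s) = (G⁰)^{1−s}(G¹)^s`, and (MT) reads
`S⁰ + Q ⪰ S¹·Q` coefficientwise (`S^j = 1 − G^j`, `Q = e^Δ − 1 − Δ`, `Δ = log(G⁰/G¹) ⪰ 0`).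
CENSUS (seat, gen 12, exact rechecks): (MT-3) = (T3∀) (gen 11: 2^[4] exhaustive 3.8·10⁸ cells, adversarial k ≤ 7); (MT-4): 820 random increasing 4-tuples on
k ≤ 5 coordinates with adversarially minimised `p` (pattern search), 0 violations; (MT-5): 820 random 5-tuples, k ≤ 5, 0 violations.  The averaged form
`Σ_e [E_3 − p_e ∂_e E_3] ≥ 0` (⟺ `λ ↦ E_3(μ_{λp})/λ^k` non-increasing; selection-free; also ⟹ `C_3`) is census-clean as well.  NEGATIVE facts (memo):
the tensor-Bernstein ("comb") version of (T3) is FALSE from 5 coordinates on (true exhaustively on 2^[4]); single-coordinate Bernstein positivity of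
`3B₂ − 2B₃` along a second coordinate is FALSE at the twisted (2,2,2) triple (k = 6); conditioning `μ_p` on a general decreasing event instead of `μ_q` is FALSE.
HONEST FRAMING: typed conjecture + reductions; Sahi's `C_k` / Kahn's Conjecture 5 and (MT-k), k ≥ 3, remain OPEN.  Axioms standard. [this work]
-/

noncomputable section

open scoped Classical

namespace Summit.CriticalPhenomena.PercolationContinuityZ3.Theorems

namespace SahiCoordinateAntitone

open Finset Function
open Literature.Combinatorics.Sahi2008
open Literature.Probability.Percolation.DecisionTree (ind ind_of_mem ind_of_not_mem ind_nonneg)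
open SahiCoordinateBernstein (coordPiece₁ coordPiece₂ sahiE_three_decomp_coord)
open SahiCoordinateTwoThirds (TwoThirds coordPiece₂_le_coordPiece₁ masterFamilyNonneg_three_of_twoThirds ind_secAt_vec3)

/-! ### 1. The antitone master conjecture, typed for every order -/

/-- **CONJECTURE (MT-k, "antitone master form")**, an obligation of this programme (NOT a published fact): for every finite cube, every `k`
increasing events `U_j` and parameters `p ≤ p'` (coordinatewise), `E_k(μ_{p'}; 1_U)·∏_e p_e ≤ E_k(μ_p; 1_U)·∏_e p'_e` — i.e. `p ↦ E_k(μ_p; 1_U)/μ_p({⊤})`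
is antitone.  Theorem for `k ≤ 2` (Harris on sections); for `k = 3` equivalent to (T3∀) (`masterAntitone_three_of_twoThirds` and memo §4.35); implies
`MasterFamilyNonneg k` (`masterFamilyNonneg_of_masterAntitone`).  Census: k = 3 = (T3∀) (2^[4] exhaustive, adversarial ≤ 7 coordinates); k = 4, 5: 820 random
tuples each on ≤ 5 coordinates with adversarial `p`, no violation (memo SAHI-ROUTE §4.35). [cite: Kahn2022, Conj. 5 (arXiv p. 3); Sahi2008, Conj. 5] [status: open] -/
@[conjecture] def MasterAntitone (k : ℕ) : Prop :=
  ∀ (ι : Type) [Fintype ι] (p p' : ι → unitInterval) (U : Fin k → Set (Set ι)),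
    (∀ j, IsUpperSet (U j)) → (∀ e, p e ≤ p' e) →
      sahiE (bernoulliWeight p') k (fun j => ind (U j)) * ∏ e, (p e : ℝ) ≤
        sahiE (bernoulliWeight p) k (fun j => ind (U j)) * ∏ e, (p' e : ℝ)

/-! ### 2. Multiplicative expectations kill every `E_k`, `k ≥ 2`; the all-ones parameter is the point mass at `⊤` -/

section General

variable {α : Type*} [Fintype α]

/-- If the expectation under a weight is MULTIPLICATIVE (`E(fg) = E(f)E(g)`, e.g. a point mass) then `E_{n+2} ≡ 0` for every `n`
(induction along the Lieb–Sahi recursion; `E_2 = E(fg) − E(f)E(g)` is the base). [this work] -/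
theorem sahiE_eq_zero_of_ex_mul (μ : α → ℝ) (hμ : ∀ f g : α → ℝ, ex μ (f * g) = ex μ f * ex μ g) :
    ∀ (n : ℕ) (F : Fin (n + 2) → α → ℝ), sahiE μ (n + 2) F = 0 := by
  intro n
  induction n with
  | zero =>
    intro F
    rw [sahiE_two_apply, hμ, sub_self]
  | succ n ih =>
    intro F
    rw [sahiE_succ_succ, ih (Fin.tail F), zero_mul, sub_zero]
    exact Finset.sum_eq_zero fun i _ => ih _

end General

variable {ι : Type} [Fintype ι]

/-- The all-ones parameter `p ≡ 1`. [folklore] -/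
def onesParam (ι : Type) : ι → unitInterval := fun _ => 1

/-- At `p ≡ 1` the product weight is the point mass at the full configuration `⊤ = Set.univ`. [folklore] -/
theorem bernoulliWeight_onesParam (ω : Set ι) :
    bernoulliWeight (onesParam ι) ω = if ω = Set.univ then 1 else 0 := by
  show (∏ e, if e ∈ ω then ((onesParam ι e : unitInterval) : ℝ) else 1 - ((onesParam ι e : unitInterval) : ℝ)) = _
  simp only [onesParam, Set.Icc.coe_one, sub_self]
  by_cases h : ω = Set.univ
  · rw [if_pos h]
    exact Finset.prod_eq_one fun e _ => by rw [if_pos (h ▸ Set.mem_univ e)]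
  · rw [if_neg h]
    obtain ⟨i, hi⟩ : ∃ i, i ∉ ω := by
      by_contra hc
      push Not at hc
      exact h (Set.eq_univ_iff_forall.2 hc)
    exact Finset.prod_eq_zero (Finset.mem_univ i) (by rw [if_neg hi])

/-- Expectation at `p ≡ 1` is evaluation at `⊤`. [folklore] -/
theorem ex_onesParam (f : Set ι → ℝ) : ex (bernoulliWeight (onesParam ι)) f = f Set.univ := by
  rw [ex_def, Finset.sum_eq_single Set.univ]
  · rw [bernoulliWeight_onesParam, if_pos rfl, one_mul]
  · intro ω _ hω
    rw [bernoulliWeight_onesParam, if_neg hω, zero_mul]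
  · intro h
    exact absurd (Finset.mem_univ _) h

/-- Every `E_k`, `k ≥ 2`, vanishes at `p ≡ 1` (the weight is a point mass, so expectation is multiplicative). [this work] -/
theorem sahiE_onesParam_eq_zero (n : ℕ) (F : Fin (n + 2) → Set ι → ℝ) :
    sahiE (bernoulliWeight (onesParam ι)) (n + 2) F = 0 :=
  sahiE_eq_zero_of_ex_mul _ (fun f g => by simp only [ex_onesParam, Pi.mul_apply]) n F

/-- `∏_e p_e = 1` at `p ≡ 1`. [folklore] -/
theorem prod_onesParam : ∏ e, ((onesParam ι e : unitInterval) : ℝ) = 1 :=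
  Finset.prod_eq_one fun e _ => by simp [onesParam]

/-! ### 3. The reduction: (MT-k) ⟹ Sahi's `C_k` on cubes, every `k ≥ 2` -/

/-- **(MT-k) ⟹ `MasterFamilyNonneg k`** for every `k ≥ 2`: compare `p` with `p' ≡ 1`, where `E_k` vanishes. [this work] -/
theorem masterFamilyNonneg_of_masterAntitone (n : ℕ) (h : MasterAntitone (n + 2)) : MasterFamilyNonneg (n + 2) := by
  intro κ _ p U hU
  have key := h κ p (onesParam κ) U hU (fun e => unitInterval.le_one (p e))
  rw [sahiE_onesParam_eq_zero, zero_mul, prod_onesParam, mul_one] at key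
  exact key

/-- In particular (MT-3) ⟹ Kahn's `C_3` for product measures. [this work] -/
theorem masterFamilyNonneg_three_of_masterAntitone (h : MasterAntitone 3) : MasterFamilyNonneg 3 :=
  masterFamilyNonneg_of_masterAntitone 1 h

/-! ### 4. Order three: (T3∀) ⟹ (MT-3) -/

/-- The real-variable core: with `E(s) = (1−s)E₀ + sE₁ + s(1−s)[(1−s)b₁ + s b₂]`, the hypotheses `E₀ ≥ 0`, `b₂ + E₀ ≥ 0` (= (T3) at the coordinate) and
`b₂ ≤ b₁` give `E(y)·x ≤ E(x)·y` for `0 ≤ x ≤ y ≤ 1`; indeed `yE(x) − xE(y) = (y − x)·[E₀ + xy((2−x−y)(b₁−b₂) + b₂)]`. [this work] -/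
theorem antitone_core {E0 E1 b1 b2 x y : ℝ} (hE0 : 0 ≤ E0) (hT3 : 0 ≤ b2 + E0) (hb : b2 ≤ b1)
    (hx0 : 0 ≤ x) (hxy : x ≤ y) (hy1 : y ≤ 1) :
    ((1 - y) * E0 + y * E1 + y * (1 - y) * ((1 - y) * b1 + y * b2)) * x ≤
      ((1 - x) * E0 + x * E1 + x * (1 - x) * ((1 - x) * b1 + x * b2)) * y := by
  have key : ((1 - x) * E0 + x * E1 + x * (1 - x) * ((1 - x) * b1 + x * b2)) * y
      - ((1 - y) * E0 + y * E1 + y * (1 - y) * ((1 - y) * b1 + y * b2)) * x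
      = (y - x) * (E0 + x * y * ((2 - x - y) * (b1 - b2) + b2)) := by ring
  have hxy0 : 0 ≤ x * y := mul_nonneg hx0 (le_trans hx0 hxy)
  have hxy1 : x * y ≤ 1 := by nlinarith
  have h2 : 0 ≤ 2 - x - y := by linarith
  have hβ : b2 ≤ (2 - x - y) * (b1 - b2) + b2 := by nlinarith [mul_nonneg h2 (sub_nonneg.2 hb)]
  have hbr : 0 ≤ E0 + x * y * ((2 - x - y) * (b1 - b2) + b2) := by
    by_cases hs : 0 ≤ (2 - x - y) * (b1 - b2) + b2
    · nlinarith [mul_nonneg hxy0 hs]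
    · push Not at hs
      nlinarith [mul_nonneg_of_nonpos_of_nonpos hs.le (sub_nonpos.2 hxy1)]
  nlinarith [mul_nonneg (sub_nonneg.2 hxy) hbr, key]

/-- **ONE COORDINATE**: under (T3∀), raising `p_e` from `s` to `s'` can only lower `E_3/p_e`:
`E_3(μ_{p[e↦s']}; 1_A,1_B,1_C)·s ≤ E_3(μ_{p[e↦s]}; 1_A,1_B,1_C)·s'`. [this work] -/
theorem sahiE_three_update_antitone (hT : TwoThirds) (p : ι → unitInterval) (e : ι) {A B C : Set (Set ι)}
    (hA : IsUpperSet A) (hB : IsUpperSet B) (hC : IsUpperSet C) {s s' : unitInterval} (hss : s ≤ s') :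
    sahiE (bernoulliWeight (update p e s')) 3 ![ind A, ind B, ind C] * (s : ℝ) ≤
      sahiE (bernoulliWeight (update p e s)) 3 ![ind A, ind B, ind C] * (s' : ℝ) := by
  have hU : ∀ j, IsUpperSet ((![A, B, C] : Fin 3 → Set (Set ι)) j) := by
    intro j
    fin_cases j
    · exact hA
    · exact hB
    · exact hC
  -- the one-coordinate decomposition at a general value `σ` of `p_e` (pieces do not depend on `p_e`)
  have hdec : ∀ σ : unitInterval,
      sahiE (bernoulliWeight (update p e σ)) 3 ![ind A, ind B, ind C] =
        (1 - (σ : ℝ)) * sahiE (bernoulliWeight (update p e σ)) 3 (fun j => ind (secAt e false ((![A, B, C] : Fin 3 → Set (Set ι)) j)))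
        + (σ : ℝ) * sahiE (bernoulliWeight (update p e σ)) 3 (fun j => ind (secAt e true ((![A, B, C] : Fin 3 → Set (Set ι)) j)))
        + (σ : ℝ) * (1 - (σ : ℝ)) * ((1 - (σ : ℝ)) * coordPiece₁ p e ![A, B, C] + (σ : ℝ) * coordPiece₂ p e ![A, B, C]) := by
    intro σ
    have h := sahiE_three_decomp_coord (update p e σ) e ![A, B, C]
    rw [Pointwise.ind_vec3, update_self, SahiCoordinateChord.coordPiece₁_update_same,
      SahiCoordinateChord.coordPiece₂_update_same] at h
    exact h
  -- the sections do not depend on `p_e`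
  have h0 := sahiE_three_secAt_update p e false s' s ![A, B, C]
  have h1 := sahiE_three_secAt_update p e true s' s ![A, B, C]
  -- inputs: `E_3(0-sections) ≥ 0` (from (T3∀) via gen 11's reduction), (T3) at `e`, and `b₂ ≤ b₁`
  have hC3 := masterFamilyNonneg_three_of_twoThirds hT
  have hE0 : 0 ≤ sahiE (bernoulliWeight (update p e s)) 3
      (fun j => ind (secAt e false ((![A, B, C] : Fin 3 → Set (Set ι)) j))) :=
    hC3 ι (update p e s) (fun j => secAt e false ((![A, B, C] : Fin 3 → Set (Set ι)) j))
      fun j => isUpperSet_secAt e false (hU j)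
  have hT3 := hT ι (update p e s) A B C hA hB hC e
  rw [SahiCoordinateChord.coordPiece₂_update_same, ← ind_secAt_vec3] at hT3
  have hb := coordPiece₂_le_coordPiece₁ p e hA hB hC
  rw [hdec s', hdec s, h0, h1]
  exact antitone_core hE0 hT3 hb (s).2.1 hss (s').2.2

/-- **(T3∀) ⟹ (MT-3)**: under the two-thirds conjecture, `p ↦ E_3(μ_p; 1_U)/∏ p_e` is antitone (one coordinate at a time). [this work] -/
theorem masterAntitone_three_of_twoThirds (hT : TwoThirds) : MasterAntitone 3 := by
  intro κ _ p p' U hU hpp'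
  have hUeq : (fun j => ind (U j)) = ![ind (U 0), ind (U 1), ind (U 2)] := by
    funext j; fin_cases j <;> rfl
  rw [hUeq]
  -- interpolate: `p'` on `S`, `p` off `S`
  suffices h : ∀ S : Finset κ,
      sahiE (bernoulliWeight (fun e => if e ∈ S then p' e else p e)) 3 ![ind (U 0), ind (U 1), ind (U 2)] * ∏ e ∈ S, (p e : ℝ) ≤
        sahiE (bernoulliWeight p) 3 ![ind (U 0), ind (U 1), ind (U 2)] * ∏ e ∈ S, (p' e : ℝ) by
    have hu := h Finset.univ
    simp only [Finset.mem_univ, if_true] at hu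
    exact hu
  intro S
  induction S using Finset.induction_on with
  | empty => simp
  | insert a S haS ih =>
    set q : κ → unitInterval := fun e => if e ∈ S then p' e else p e with hq
    have hq' : (fun e => if e ∈ insert a S then p' e else p e) = update q a (p' a) := by
      funext e
      by_cases hea : e = a
      · subst hea
        rw [update_self, if_pos (Finset.mem_insert_self e S)]
      · rw [update_of_ne hea]
        simp only [hq, Finset.mem_insert, hea, false_or]
    have hqa : update q a (p a) = q := by
      funext e
      by_cases hea : e = a
      · subst hea
        rw [update_self]
        simp only [hq, if_neg haS]
      · rw [update_of_ne hea]
    rw [hq', Finset.prod_insert haS, Finset.prod_insert haS]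
    have step := sahiE_three_update_antitone hT q a (hU 0) (hU 1) (hU 2) (hpp' a)
    rw [hqa] at step
    have hprod : 0 ≤ ∏ e ∈ S, (p e : ℝ) := Finset.prod_nonneg fun e _ => (p e).2.1
    have hpa' : 0 ≤ (p' a : ℝ) := (p' a).2.1
    calc sahiE (bernoulliWeight (update q a (p' a))) 3 ![ind (U 0), ind (U 1), ind (U 2)] * ((p a : ℝ) * ∏ e ∈ S, (p e : ℝ))
        = (sahiE (bernoulliWeight (update q a (p' a))) 3 ![ind (U 0), ind (U 1), ind (U 2)] * (p a : ℝ)) * ∏ e ∈ S, (p e : ℝ) := by ring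
      _ ≤ (sahiE (bernoulliWeight q) 3 ![ind (U 0), ind (U 1), ind (U 2)] * (p' a : ℝ)) * ∏ e ∈ S, (p e : ℝ) :=
          mul_le_mul_of_nonneg_right step hprod
      _ = (sahiE (bernoulliWeight q) 3 ![ind (U 0), ind (U 1), ind (U 2)] * ∏ e ∈ S, (p e : ℝ)) * (p' a : ℝ) := by ring
      _ ≤ (sahiE (bernoulliWeight p) 3 ![ind (U 0), ind (U 1), ind (U 2)] * ∏ e ∈ S, (p' e : ℝ)) * (p' a : ℝ) :=
          mul_le_mul_of_nonneg_right ih hpa'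
      _ = sahiE (bernoulliWeight p) 3 ![ind (U 0), ind (U 1), ind (U 2)] * ((p' a : ℝ) * ∏ e ∈ S, (p' e : ℝ)) := by ring

end SahiCoordinateAntitone

end Summit.CriticalPhenomena.PercolationContinuityZ3.Theorems
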